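import Literature.IUT.HodgeTheaters.PuncturedEllipticCoveringsArrowClaimsOfLawsIndex
import HarnessLib

/-!
# [IUTchI] §1 p. 38 — `Π_{X̲→} ∩ Δ_C = jKer` and the normality of `Π_{X̲→}`, `Π_{C̲→}` in `Π_C̲`, DERIVED

Mochizuki, *Inter-universal Teichmüller theory I*, kurims manuscript (May 2020), §1 p. 38
[cite: Mochizuki2012, IUTchI §1 p.38] (D-0012 claim key, status disputed).  PROOF-ONLY; file B3 of the
«hA re-grounding» series (abc-iut-L5-lead RULINGS #58 (10) GO); companion of `PuncturedEllipticCoverings.lean`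
(p404449), `…ArrowClaimsOfLaws.lean` (p444784, B1), `…ArrowClaimsOfLawsIndex.lean` (B2).  No `def`, no
instance, no new `Prop` fact.

Print (p. 38 l. 18–33): "the decomposition group associated to this cusp `2ε` determines a section
`σ : G_k → J_C` … since [in light of the assumption (∗)!] the natural [outer] action of `G_k` on
`Δ_ε⁺ × Gal(X̲/C̲)` is trivial, we conclude that `σ` is completely determined by `2ε`, and that the subgroup
`Im(σ) ⊆ J_C` determined by the image of `σ` is normal in `J_C`. … `Im(σ)` lies inside the subgroup `J_X ⊆ J_C`.
Thus, the subgroups `Im(σ) ⊆ J_X`, `Im(σ) × Gal(X̲/C̲) ⊆ J_C` determine … open immersions [with normal image] of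
profinite groups".

WHAT IS PROVED (laws (L3), (L4), `hι` as in B1; `Π_{X̲→} = D_{2ε} · jKer`, `Π_{C̲→} = D_{2ε} · galKer`):
* `CuspGalois.piXarrow_inf_deltaC_of_inertiaCentral` = the typed clause **`ArrowCoveringClaims.piXarrow_inf_delta`**
  (`Π_{X̲→} ∩ Δ_C = jKer`: "`σ` is a section", `I_{2ε}` dies in `Δ_ε` because `2ε ∉ {ε⁰, ε′, ε″}`), and its twin
  `piCarrow_inf_deltaC_of_inertiaCentral` (`Π_{C̲→} ∩ Δ_C = galKer`) — under (L4) only;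
* `CuspGalois.conj_mul_inv_mem_jKer_of_mem_piXbar` — **every `g ∈ Π_X̲` centralises `Δ_C̲ / jKer = Δ_ε⁺ ×
  Gal(X̲/C̲)`**: on `Δ_ε⁺ = Δ_X̲/jKer` because `Δ_ε⁺` is generated by the image of `I_ε′` (B1) on which `g` acts
  trivially by (L4) ("the natural action of `G_k` on `Δ_ε⁺` is trivial"); on `ι̲` because `a := [g, ι̲]` lies in
  `Δ_X̲`, satisfies `a · ι(a) ≡ [g, ι̲²] ≡ 1` with `ι` trivial on `Δ_ε⁺`, so `a² ≡ 1 ≡ a^l`, whence `a ≡ 1`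
  (`l` odd) — the group-theoretic content of "`G_k` acts trivially on `Gal(X̲/C̲)`";
* `CuspGalois.piXarrow_normal_of_laws`, `CuspGalois.piCarrow_normal_of_laws` = the typed clauses
  **`ArrowCoveringClaims.piXarrow_normal`**, **`….piCarrow_normal`** ("open immersions [with normal image]").

HONEST FRAMING: nothing here asserts abc proved or refuted or takes a side on [IUTchIII] Cor. 3.12; a clause
derived under named laws is an implication, not a discharge of the laws; typed ≠ inhabited ≠ discharged.
-/

namespace Literature.IUT.HodgeTheaters

namespace PuncturedEllipticData

open scoped Pointwise
open Topology Literature.AnabelianGeometry.AbsoluteAnabelian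

universe u

/-! ### Generic: membership in a join `H ⊔ K` when `K` is normalised inside a common over-group -/

section Generic

variable {G : Type*} [Group G]

/-- If `H, K ≤ L` and `K` is normal in `L`, every element of `H ⊔ K` is a product `h · k`. (Elementary.)
[claim: Mochizuki2012, status: disputed] -/
theorem exists_mul_eq_of_mem_sup_of_normal_subgroupOf {H K L : Subgroup G} (hH : H ≤ L) (hK : K ≤ L)
    (hn : (K.subgroupOf L).Normal) {x : G} (hx : x ∈ H ⊔ K) : ∃ h ∈ H, ∃ k ∈ K, h * k = x := by
  haveI := hn
  have hxL : x ∈ L := (sup_le hH hK) hx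
  have hx' : (⟨x, hxL⟩ : L) ∈ H.subgroupOf L ⊔ K.subgroupOf L := by
    rw [← Subgroup.subgroupOf_sup hH hK, Subgroup.mem_subgroupOf]; exact hx
  have hx'' : (⟨x, hxL⟩ : L) ∈ ((H.subgroupOf L ⊔ K.subgroupOf L : Subgroup L) : Set L) := hx'
  rw [Subgroup.mul_normal] at hx''
  obtain ⟨h, hh, k, hk, hhk⟩ := Set.mem_mul.mp hx''
  refine ⟨(h : G), Subgroup.mem_subgroupOf.mp hh, (k : G), Subgroup.mem_subgroupOf.mp hk, ?_⟩
  exact congrArg Subtype.val hhk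

end Generic

variable {D : PuncturedEllipticData.{u}}

/-- `I_{2ε} ⊆ Ker(Δ_X̲ ↠ Δ_ε)`: the chosen cusp over `2ε̲` is a nonzero cusp `≠ ε′, ε″` ("since `2 ≠ ±1 (mod l)`",
p. 38 l. 17). ([IUTchI] §1 p.38) [claim: Mochizuki2012, status: disputed] -/
theorem inertia_twoε_le_deltaEpsKer : D.inertia D.twoε ≤ D.deltaEpsKer := by
  have h : D.inertia D.twoε ≤ ⨆ (y : {y : D.Cusp // D.IsNonzeroCusp y ∧ y ≠ D.ε1 ∧ y ≠ D.ε2}),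
      D.inertia y.1 := le_iSup (fun y : {y : D.Cusp // D.IsNonzeroCusp y ∧ y ≠ D.ε1 ∧ y ≠ D.ε2} =>
        D.inertia y.1) ⟨D.twoε, D.twoε_ne.1, D.twoε_ne.2.1, D.twoε_ne.2.2⟩
  exact h.trans le_sup_right

/-- An element of `Π_C̲` factors as `p · δ` with `p ∈ Π_{X̲→}` and `δ ∈ Δ_C̲` (`Π_{X̲→} ↠ G_k`, p. 38: `σ` is a
section). ([IUTchI] §1 p.38) [claim: Mochizuki2012, status: disputed] -/
theorem exists_piXarrow_mul_deltaCbar {g : D.PiC} (hg : g ∈ D.PiCbar) :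
    ∃ p ∈ D.piXarrow, ∃ δ ∈ D.DeltaCbar, p * δ = g := by
  obtain ⟨p, hp⟩ := D.aug_piXarrow_surjective (D.E.aug g)
  refine ⟨(p : D.PiC), p.2, (p : D.PiC)⁻¹ * g, ⟨D.PiCbar.mul_mem (D.PiCbar.inv_mem
    (D.piXarrow_le_piCbar p.2)) hg, ?_⟩, by group⟩
  change (p : D.PiC)⁻¹ * g ∈ D.E.geom
  rw [D.E.mem_geom, map_mul, map_inv]
  have : D.E.aug (p : D.PiC) = D.E.aug g := hp
  rw [this, inv_mul_cancel]

namespace CuspGalois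

variable (C : D.CuspGalois)

/-! ### `Π_{X̲→} ∩ Δ_C = jKer`, `Π_{C̲→} ∩ Δ_C = galKer` (under (L4)) -/

include C in
/-- **[IUTchI] §1 p. 38 — the typed clause `ArrowCoveringClaims.piXarrow_inf_delta` (`Π_{X̲→} ∩ Δ_C = jKer`, i.e.
"`σ` is a section" of `J_C ↠ G_k`) DERIVED** under (L4). ([IUTchI] §1 p.38) [claim: Mochizuki2012, status: disputed] -/
theorem piXarrow_inf_deltaC_of_inertiaCentral
    (hI3 : ∀ (x : D.Cusp), ∀ g ∈ D.PiXbar, ∀ z ∈ D.inertia x, g * z * g⁻¹ * z⁻¹ ∈ D.modLKer) :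
    D.piXarrow ⊓ D.DeltaC = D.jKer := by
  refine le_antisymm ?_ D.jKer_le_piXarrow_inf_delta
  rintro x ⟨hx, hxΔ⟩
  obtain ⟨d, hd, j, hj, rfl⟩ := exists_mul_eq_of_mem_sup_of_normal_subgroupOf
    ((D.decomp_le D.twoε).trans inf_le_right)
    (D.jKer_le_deltaXbar.trans (D.deltaXbar_le_piXbar.trans D.piXbar_le_piCbar))
    (C.jKer_normal_of_inertiaCentral hI3) hx
  have hdΔ : d ∈ D.DeltaC := by
    have : d * j * j⁻¹ ∈ D.DeltaC := D.DeltaC.mul_mem hxΔ (D.DeltaC.inv_mem (D.jKer_le_deltaXbar hj).2)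
    simpa only [mul_inv_cancel_right] using this
  exact D.jKer.mul_mem (D.deltaEpsKer_le_jKer (D.inertia_twoε_le_deltaEpsKer ⟨hd, hdΔ⟩)) hj

include C in
/-- `Π_{C̲→} ∩ Δ_C = galKer` (the `Δ`-part of `Π_{C̲→} = D_{2ε} · galKer`), under (L4).
([IUTchI] §1 p.38) [claim: Mochizuki2012, status: disputed] -/
theorem piCarrow_inf_deltaC_of_inertiaCentral
    (hI3 : ∀ (x : D.Cusp), ∀ g ∈ D.PiXbar, ∀ z ∈ D.inertia x, g * z * g⁻¹ * z⁻¹ ∈ D.modLKer) :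
    D.piCarrow ⊓ D.DeltaC = D.galKer := by
  refine le_antisymm ?_ (le_inf le_sup_right (D.galKer_le_deltaCbar.trans inf_le_right))
  rintro x ⟨hx, hxΔ⟩
  obtain ⟨d, hd, m, hm, rfl⟩ := exists_mul_eq_of_mem_sup_of_normal_subgroupOf
    ((D.decomp_le D.twoε).trans inf_le_right)
    D.galKer_le_piCbar' (D.galKer_normal_subgroupOf (C.jKer_normal_of_inertiaCentral hI3)) hx
  have hdΔ : d ∈ D.DeltaC := by
    have : d * m * m⁻¹ ∈ D.DeltaC := D.DeltaC.mul_mem hxΔ (D.DeltaC.inv_mem (D.galKer_le_deltaCbar hm).2)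
    simpa only [mul_inv_cancel_right] using this
  have hjG : D.jKer ≤ D.galKer := le_sup_left
  exact D.galKer.mul_mem (hjG (D.deltaEpsKer_le_jKer (D.inertia_twoε_le_deltaEpsKer ⟨hd, hdΔ⟩))) hm

/-! ### Every `g ∈ Π_X̲` centralises `Δ_C̲ / jKer = Δ_ε⁺ × Gal(X̲/C̲)` -/

include C in
/-- **"the natural action of `G_k` on `Δ_ε⁺` is trivial" DERIVED**: for `g ∈ Π_X̲` and `x ∈ Δ_X̲`,
`g x g⁻¹ x⁻¹ ∈ jKer` — `Δ_ε⁺ = Δ_X̲/jKer` is generated by the image of `I_ε′` (B1 `inertia_ε1_sup_of_laws`), on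
which `Π_X̲` acts trivially modulo `Ker(Δ_X̲ ↠ Δ_X̲^{ab} ⊗ ℤ/l)` by (L4). ([IUTchI] §1 p.38) [claim: Mochizuki2012, status: disputed] -/
theorem conj_mul_inv_mem_jKer_of_mem_deltaXbar
    (hI3 : ∀ (x : D.Cusp), ∀ g ∈ D.PiXbar, ∀ z ∈ D.inertia x, g * z * g⁻¹ * z⁻¹ ∈ D.modLKer)
    (hL3 : ∀ c ∈ D.DeltaCbar, c ∉ D.DeltaXbar → ∀ v ∈ D.DeltaXbar,
      c * v * c⁻¹ * v ∈ D.inertia D.ε1 ⊔ D.inertia D.ε2 ⊔ D.deltaEpsKer)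
    (hι : ∃ c ∈ D.DeltaCbar, c ∉ D.DeltaXbar)
    {g x : D.PiC} (hg : g ∈ D.PiXbar) (hx : x ∈ D.DeltaXbar) : g * x * g⁻¹ * x⁻¹ ∈ D.jKer := by
  have hgC : g ∈ D.PiCbar := D.piXbar_le_piCbar hg
  have hxs : x ∈ D.inertia D.ε1 ⊔ D.jKer := by rw [C.inertia_ε1_sup_of_laws hI3 hL3 hι]; exact hx
  obtain ⟨y, hy, j, hj, rfl⟩ := exists_mul_eq_of_mem_sup_of_normal_subgroupOf (D.inertia_le_deltaXbar _)
    D.jKer_le_deltaXbar (D.normal_subgroupOf_of_modLKer_le D.modLKer_le_jKer D.jKer_le_deltaXbar le_rfl) hxs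
  have hyΔ : y ∈ D.DeltaXbar := D.inertia_le_deltaXbar _ hy
  have h1 : g * y * g⁻¹ * y⁻¹ ∈ D.jKer := D.modLKer_le_jKer (hI3 _ g hg y hy)
  have h2 : g * j * g⁻¹ * j⁻¹ ∈ D.jKer :=
    D.jKer.mul_mem (C.conj_mem_jKer_of_inertiaCentral hI3 hgC hj) (D.jKer.inv_mem hj)
  have h3 : y * (g * j * g⁻¹ * j⁻¹) * y⁻¹ ∈ D.jKer :=
    C.conj_mem_jKer_of_inertiaCentral hI3 (D.piXbar_le_piCbar (D.deltaXbar_le_piXbar hyΔ)) h2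
  have e : g * (y * j) * g⁻¹ * (y * j)⁻¹ = (g * y * g⁻¹ * y⁻¹) * (y * (g * j * g⁻¹ * j⁻¹) * y⁻¹) := by group
  rw [e]
  exact D.jKer.mul_mem h1 h3

include C in
/-- **"the natural action of `G_k` on `Gal(X̲/C̲)` is trivial" — group-theoretic content, DERIVED**: for
`g ∈ Π_X̲` and `ι̲ ∈ Δ_C̲ ∖ Δ_X̲`, `a := g ι̲ g⁻¹ ι̲⁻¹ ∈ jKer`.  Indeed `a ∈ Δ_X̲`; `g ι̲² g⁻¹ ι̲⁻² = a · ι̲ a ι̲⁻¹ ≡ a²`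
(`ι` is trivial on `Δ_ε⁺`) and `≡ 1` (`ι̲² ∈ Δ_X̲`, previous lemma); `a^l ≡ 1`; `l` odd. ([IUTchI] §1 p.38)
[claim: Mochizuki2012, status: disputed] -/
theorem conj_mul_inv_mem_jKer_of_not_mem_deltaXbar
    (hI3 : ∀ (x : D.Cusp), ∀ g ∈ D.PiXbar, ∀ z ∈ D.inertia x, g * z * g⁻¹ * z⁻¹ ∈ D.modLKer)
    (hL3 : ∀ c ∈ D.DeltaCbar, c ∉ D.DeltaXbar → ∀ v ∈ D.DeltaXbar,
      c * v * c⁻¹ * v ∈ D.inertia D.ε1 ⊔ D.inertia D.ε2 ⊔ D.deltaEpsKer)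
    (hι : ∃ c ∈ D.DeltaCbar, c ∉ D.DeltaXbar)
    {g c : D.PiC} (hg : g ∈ D.PiXbar) (hc : c ∈ D.DeltaCbar) (hcX : c ∉ D.DeltaXbar) :
    g * c * g⁻¹ * c⁻¹ ∈ D.jKer := by
  obtain ⟨k, hk⟩ := D.exists_l_succ_eq_two_mul
  have hcP : c ∉ D.PiX := D.not_mem_piX_of_mem_deltaCbar hc hcX
  have hgcP : g * c * g⁻¹ ∉ D.PiX := fun h => hcP (by
    have := D.piX_normal.conj_mem _ h g⁻¹
    simpa only [inv_inv, ← mul_assoc, inv_mul_cancel, one_mul, inv_mul_cancel_right] using this)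
  -- `a ∈ Δ_X̲`
  have haX : g * c * g⁻¹ * c⁻¹ ∈ D.PiX := by
    rw [Subgroup.mul_mem_iff_of_index_two D.index_piX, Subgroup.inv_mem_iff]
    exact ⟨fun h => absurd h hgcP, fun h => absurd h hcP⟩
  have haC : g * c * g⁻¹ * c⁻¹ ∈ D.PiCbar :=
    D.PiCbar.mul_mem (D.PiCbar.mul_mem (D.PiCbar.mul_mem (D.piXbar_le_piCbar hg) hc.1)
      (D.PiCbar.inv_mem (D.piXbar_le_piCbar hg))) (D.PiCbar.inv_mem hc.1)
  have haΔ : g * c * g⁻¹ * c⁻¹ ∈ D.DeltaC :=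
    D.DeltaC.mul_mem (D.E.normal_geom.conj_mem c hc.2 g) (D.DeltaC.inv_mem hc.2)
  have ha : g * c * g⁻¹ * c⁻¹ ∈ D.DeltaXbar := ⟨⟨haX, haC⟩, haΔ⟩
  set a := g * c * g⁻¹ * c⁻¹ with ha_def
  -- `ι̲² ∈ Δ_X̲`, so `g ι̲² g⁻¹ ι̲⁻² ∈ jKer`
  have hcc : c * c ∈ D.DeltaXbar :=
    ⟨⟨Subgroup.mul_self_mem_of_index_two D.index_piX c, D.PiCbar.mul_mem hc.1 hc.1⟩,
      D.DeltaC.mul_mem hc.2 hc.2⟩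
  have h1 : g * (c * c) * g⁻¹ * (c * c)⁻¹ ∈ D.jKer :=
    C.conj_mul_inv_mem_jKer_of_mem_deltaXbar hI3 hL3 hι hg hcc
  -- … and it equals `a · (ι̲ a ι̲⁻¹) = a² · a⁻¹ (ι̲ a ι̲⁻¹ a⁻¹) a`
  have e : g * (c * c) * g⁻¹ * (c * c)⁻¹ = a * a * (a⁻¹ * (c * a * c⁻¹ * a⁻¹) * a) := by
    rw [ha_def]; group
  -- `ι` is trivial on `Δ_ε⁺`: `ι̲ a ι̲⁻¹ a⁻¹ = [a, ι̲]⁻¹ ∈ jKer`, and its `a⁻¹`-conjugate too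
  have h2 : c * a * c⁻¹ * a⁻¹ ∈ D.jKer := by
    have := D.jKer.inv_mem (D.commutator_mem_jKer ha hc hcX)
    have e' : (a * c * a⁻¹ * c⁻¹)⁻¹ = c * a * c⁻¹ * a⁻¹ := by group
    rwa [e'] at this
  have h3 : a⁻¹ * (c * a * c⁻¹ * a⁻¹) * a ∈ D.jKer := by
    have := C.conj_mem_jKer_of_inertiaCentral hI3
      (D.PiCbar.inv_mem (D.piXbar_le_piCbar (D.deltaXbar_le_piXbar ha))) h2
    simpa only [inv_inv] using this
  have haa : a * a ∈ D.jKer := by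
    rw [e] at h1
    have := D.jKer.mul_mem h1 (D.jKer.inv_mem h3)
    simpa only [mul_inv_cancel_right] using this
  -- `a^l ∈ jKer` and `l + 1 = 2k`, hence `a ∈ jKer`
  have hal : a ^ D.l ∈ D.jKer := D.modLKer_le_jKer (D.pow_l_mem_modLKer ha)
  have ha2k : a ^ (D.l + 1) ∈ D.jKer := by
    rw [hk, pow_mul, pow_two]
    exact D.jKer.pow_mem haa k
  have e2 : a = (a ^ D.l)⁻¹ * a ^ (D.l + 1) := by rw [pow_succ, inv_mul_cancel_left]
  rw [e2]
  exact D.jKer.mul_mem (D.jKer.inv_mem hal) ha2k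

include C in
/-- Every `g ∈ Π_X̲` centralises `Δ_C̲` modulo `jKer`. ([IUTchI] §1 p.38) [claim: Mochizuki2012, status: disputed] -/
theorem conj_mul_inv_mem_jKer_of_mem_deltaCbar
    (hI3 : ∀ (x : D.Cusp), ∀ g ∈ D.PiXbar, ∀ z ∈ D.inertia x, g * z * g⁻¹ * z⁻¹ ∈ D.modLKer)
    (hL3 : ∀ c ∈ D.DeltaCbar, c ∉ D.DeltaXbar → ∀ v ∈ D.DeltaXbar,
      c * v * c⁻¹ * v ∈ D.inertia D.ε1 ⊔ D.inertia D.ε2 ⊔ D.deltaEpsKer)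
    (hι : ∃ c ∈ D.DeltaCbar, c ∉ D.DeltaXbar)
    {g δ : D.PiC} (hg : g ∈ D.PiXbar) (hδ : δ ∈ D.DeltaCbar) : g * δ * g⁻¹ * δ⁻¹ ∈ D.jKer := by
  by_cases hδX : δ ∈ D.DeltaXbar
  · exact C.conj_mul_inv_mem_jKer_of_mem_deltaXbar hI3 hL3 hι hg hδX
  · exact C.conj_mul_inv_mem_jKer_of_not_mem_deltaXbar hI3 hL3 hι hg hδ hδX

/-! ### Normality of `Π_{X̲→}` and `Π_{C̲→}` in `Π_C̲` -/

include C in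
/-- Conjugation of `D_{2ε}` by `Δ_C̲` stays inside `jKer · D_{2ε}`. ([IUTchI] §1 p.38) [claim: Mochizuki2012, status: disputed] -/
theorem conj_decomp_twoε_mem
    (hI3 : ∀ (x : D.Cusp), ∀ g ∈ D.PiXbar, ∀ z ∈ D.inertia x, g * z * g⁻¹ * z⁻¹ ∈ D.modLKer)
    (hL3 : ∀ c ∈ D.DeltaCbar, c ∉ D.DeltaXbar → ∀ v ∈ D.DeltaXbar,
      c * v * c⁻¹ * v ∈ D.inertia D.ε1 ⊔ D.inertia D.ε2 ⊔ D.deltaEpsKer)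
    (hι : ∃ c ∈ D.DeltaCbar, c ∉ D.DeltaXbar)
    {δ d : D.PiC} (hδ : δ ∈ D.DeltaCbar) (hd : d ∈ D.decomp D.twoε) :
    δ * d * δ⁻¹ ∈ D.jKer ⊔ D.decomp D.twoε := by
  have hdX : d ∈ D.PiXbar := D.decomp_le D.twoε hd
  have h := D.jKer.inv_mem (C.conj_mul_inv_mem_jKer_of_mem_deltaCbar hI3 hL3 hι hdX hδ)
  have e : δ * d * δ⁻¹ = (d * δ * d⁻¹ * δ⁻¹)⁻¹ * d := by group
  rw [e]
  exact Subgroup.mul_mem _ (Subgroup.mem_sup_left h) (Subgroup.mem_sup_right hd)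

include C in
/-- **[IUTchI] §1 p. 38 — the typed clause `ArrowCoveringClaims.piXarrow_normal` ("open immersions [with normal
image]": `Π_{X̲→} ⊴ Π_C̲`) DERIVED.** ([IUTchI] §1 p.38) [claim: Mochizuki2012, status: disputed] -/
theorem piXarrow_normal_of_laws
    (hI3 : ∀ (x : D.Cusp), ∀ g ∈ D.PiXbar, ∀ z ∈ D.inertia x, g * z * g⁻¹ * z⁻¹ ∈ D.modLKer)
    (hL3 : ∀ c ∈ D.DeltaCbar, c ∉ D.DeltaXbar → ∀ v ∈ D.DeltaXbar,
      c * v * c⁻¹ * v ∈ D.inertia D.ε1 ⊔ D.inertia D.ε2 ⊔ D.deltaEpsKer)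
    (hι : ∃ c ∈ D.DeltaCbar, c ∉ D.DeltaXbar) :
    (D.piXarrow.subgroupOf D.PiCbar).Normal := by
  refine (Subgroup.normal_subgroupOf_iff D.piXarrow_le_piCbar).mpr fun n g hn hg => ?_
  -- `g = p δ` with `p ∈ Π_{X̲→}`, `δ ∈ Δ_C̲`; it suffices to conjugate by `δ`
  obtain ⟨p, hp, δ, hδ, rfl⟩ := D.exists_piXarrow_mul_deltaCbar hg
  suffices h : δ * n * δ⁻¹ ∈ D.piXarrow by
    have e : p * δ * n * (p * δ)⁻¹ = p * (δ * n * δ⁻¹) * p⁻¹ := by group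
    rw [e]
    exact D.piXarrow.mul_mem (D.piXarrow.mul_mem hp h) (D.piXarrow.inv_mem hp)
  have hδC : δ ∈ D.PiCbar := D.deltaCbar_le_piCbar hδ
  have hjP : D.jKer ≤ D.piXarrow := D.jKer_le_piXarrow_inf_delta.trans inf_le_left
  have hdP : D.decomp D.twoε ≤ D.piXarrow := D.decomp_twoε_le_piXarrow
  -- `n = d j`, `d ∈ D_{2ε}`, `j ∈ jKer`
  obtain ⟨d, hd, j, hj, rfl⟩ := exists_mul_eq_of_mem_sup_of_normal_subgroupOf
    ((D.decomp_le D.twoε).trans inf_le_right)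
    (D.jKer_le_deltaXbar.trans (D.deltaXbar_le_piXbar.trans D.piXbar_le_piCbar))
    (C.jKer_normal_of_inertiaCentral hI3) hn
  have e : δ * (d * j) * δ⁻¹ = (δ * d * δ⁻¹) * (δ * j * δ⁻¹) := by group
  rw [e]
  exact D.piXarrow.mul_mem ((sup_le hjP hdP) (C.conj_decomp_twoε_mem hI3 hL3 hι hδ hd))
    (hjP (C.conj_mem_jKer_of_inertiaCentral hI3 hδC hj))

include C in
/-- **[IUTchI] §1 p. 38 — the typed clause `ArrowCoveringClaims.piCarrow_normal` (`Π_{C̲→} ⊴ Π_C̲`) DERIVED.**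
([IUTchI] §1 p.38) [claim: Mochizuki2012, status: disputed] -/
theorem piCarrow_normal_of_laws
    (hI3 : ∀ (x : D.Cusp), ∀ g ∈ D.PiXbar, ∀ z ∈ D.inertia x, g * z * g⁻¹ * z⁻¹ ∈ D.modLKer)
    (hL3 : ∀ c ∈ D.DeltaCbar, c ∉ D.DeltaXbar → ∀ v ∈ D.DeltaXbar,
      c * v * c⁻¹ * v ∈ D.inertia D.ε1 ⊔ D.inertia D.ε2 ⊔ D.deltaEpsKer)
    (hι : ∃ c ∈ D.DeltaCbar, c ∉ D.DeltaXbar) :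
    (D.piCarrow.subgroupOf D.PiCbar).Normal := by
  haveI hgal := D.galKer_normal_subgroupOf (C.jKer_normal_of_inertiaCentral hI3)
  refine (Subgroup.normal_subgroupOf_iff D.piCarrow_le_piCbar).mpr fun n g hn hg => ?_
  obtain ⟨p, hp, δ, hδ, rfl⟩ := D.exists_piXarrow_mul_deltaCbar hg
  have hp' : p ∈ D.piCarrow := D.piXarrow_le_piCarrow hp
  suffices h : δ * n * δ⁻¹ ∈ D.piCarrow by
    have e : p * δ * n * (p * δ)⁻¹ = p * (δ * n * δ⁻¹) * p⁻¹ := by group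
    rw [e]
    exact D.piCarrow.mul_mem (D.piCarrow.mul_mem hp' h) (D.piCarrow.inv_mem hp')
  have hδC : δ ∈ D.PiCbar := D.deltaCbar_le_piCbar hδ
  have hjP : D.jKer ≤ D.piCarrow :=
    (D.jKer_le_piXarrow_inf_delta.trans inf_le_left).trans D.piXarrow_le_piCarrow
  have hdP : D.decomp D.twoε ≤ D.piCarrow := D.decomp_twoε_le_piCarrow
  have hgP : D.galKer ≤ D.piCarrow := le_sup_right
  obtain ⟨d, hd, m, hm, rfl⟩ := exists_mul_eq_of_mem_sup_of_normal_subgroupOf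
    ((D.decomp_le D.twoε).trans inf_le_right) D.galKer_le_piCbar' hgal hn
  have e : δ * (d * m) * δ⁻¹ = (δ * d * δ⁻¹) * (δ * m * δ⁻¹) := by group
  rw [e]
  refine D.piCarrow.mul_mem ((sup_le hjP hdP) (C.conj_decomp_twoε_mem hI3 hL3 hι hδ hd)) (hgP ?_)
  have := hgal.conj_mem ⟨m, D.galKer_le_piCbar' hm⟩ (Subgroup.mem_subgroupOf.mpr hm) ⟨δ, hδC⟩
  exact Subgroup.mem_subgroupOf.mp this

end CuspGalois

end PuncturedEllipticData

end Literature.IUT.HodgeTheaters
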